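import Summits.HodgeConjecture.HodgeConjecture.Theorems.BiquadraticSecantLiftBaseChangeField
import Literature.AlgebraicGeometry.Deligne1982.WeilTypeCMSignature
import Literature.AlgebraicGeometry.Deligne1982.HyperbolicOfSplitDiscriminantCMKaehler
import Literature.AlgebraicGeometry.HodgeTheory.AbelianVarietyEndomorphismsHOne
import HarnessLib

/-!
# BiquadraticSecantLift · X2 — the SIGN of Deligne's discriminant for `K = ℚ(√-d)`: `(-1)^k q > 0`

Helper file for crux X2 `BiquadraticBaseChangeHyperbolic` (stmt-HodgeConjecture-22133) of
route-HodgeConjecture-BiquadraticSecantLift. For a Weil-type CM datum `IsWeilTypeCM A φ (S + d) 1 k`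
(`K = ℚ(√-d)`, `F = ℚ`), a rational class `h` with its Rosati condition which is a real multiple of a Kähler
class, and the data `(x, ω, c, Φ, q = q₀ ∈ ℚ)` of a discriminant witness (`q₀ = t_K^{2k} det Φ`), we prove
**`(-1)^k q₀ > 0`** — the Hodge–Riemann input of X2: by Deligne (4.5) (`exists_orthogonalBasis_card_pos_eq`)
the Hermitian matrix `H₀ = t⁻¹Φᵀ` is congruent to `diag(d₁,…,d_{2k})` with exactly `k` of the (rational) `dᵢ`
positive at the complex embedding; taking determinants, `|det G|² q₀ / d^{2k} = ∏ dᵢ` has the sign `(-1)^k`.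
For `k = 3` this says `q₀ < 0`, which is what makes `-q₀ = d v²` solvable in `F' = ℚ(√m)` for a suitable `m` and
the transferred discriminant split (`BiquadraticSecantLiftBaseChangeTrace.mk_qB_eq_mk_neg_one`).

Nothing here is a case of the Hodge conjecture (HC is NOT proved; X2 is not proved by this file).

## References
[cite: Deligne1982HodgeCycles, §4 (4.5) p. 32–33, Cor. 4.2, Lemma 4.6] [cite: vanGeemen1994HodgeAV, 5.2–5.3]
[cite: Landherr1936HermitianForms]
-/

-- every declaration of this problem lives in `Summit.HodgeConjecture.HodgeConjecture.…` (summit = sub-problem)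
set_option linter.dupNamespace false

noncomputable section

open CategoryTheory Polynomial Module
open scoped Matrix ComplexConjugate
open Literature.AlgebraicTopology.SingularHomology Literature.Geometry.Kaehler
open Literature.AlgebraicGeometry.HodgeTheory
open Literature.AlgebraicGeometry.Motives (AbelianVariety IsSmoothProjective polarizationPairingOne)
open Literature.AlgebraicGeometry.VanGeemen1994 (pullbackOne)
open Literature.AlgebraicGeometry.Deligne1982

namespace Summit.HodgeConjecture.HodgeConjecture.BiquadraticSecantLift

variable {A : AbelianVariety ℂ} {φ : A ⟶ A} {d : ℕ}

/-- **Sign count**: a product of `2k` non-zero reals of which exactly `k` are positive has the sign `(-1)^k`. -/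
theorem neg_one_pow_mul_prod_pos {k : ℕ} (r : Fin (2 * k) → ℝ) (hr : ∀ i, r i ≠ 0)
    (hcount : (Finset.univ.filter fun i => 0 < r i).card = k) : 0 < (-1 : ℝ) ^ k * ∏ i, r i := by
  classical
  rw [← Finset.prod_filter_mul_prod_filter_not Finset.univ (fun i => 0 < r i)]
  have hcard : (Finset.univ.filter fun i => ¬ 0 < r i).card = k := by
    have h := Finset.card_filter_add_card_filter_not (s := Finset.univ) (fun i : Fin (2 * k) => 0 < r i)
    rw [hcount, Finset.card_univ, Fintype.card_fin] at h
    omega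
  have hpos : 0 < ∏ i ∈ Finset.univ.filter (fun i => 0 < r i), r i :=
    Finset.prod_pos fun i hi ↦ (Finset.mem_filter.1 hi).2
  have hneg : ∏ i ∈ Finset.univ.filter (fun i => ¬ 0 < r i), r i =
      (-1) ^ k * ∏ i ∈ Finset.univ.filter (fun i => ¬ 0 < r i), (-r i) := by
    rw [Finset.prod_neg, hcard, ← mul_assoc, ← pow_add, ← two_mul, pow_mul, neg_one_sq, one_pow, one_mul]
  have hneg' : 0 < ∏ i ∈ Finset.univ.filter (fun i => ¬ 0 < r i), (-r i) :=
    Finset.prod_pos fun i hi ↦ by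
      have h := (Finset.mem_filter.1 hi).2
      rcases lt_or_gt_of_ne (hr i) with h' | h'
      · exact neg_pos.2 h'
      · exact absurd h' h
  rw [hneg]
  have h1 : (-1 : ℝ) ^ k * ((∏ i ∈ Finset.univ.filter (fun i => 0 < r i), r i) *
      ((-1) ^ k * ∏ i ∈ Finset.univ.filter (fun i => ¬ 0 < r i), (-r i))) =
      ((-1 : ℝ) ^ k) ^ 2 * ((∏ i ∈ Finset.univ.filter (fun i => 0 < r i), r i) *
        ∏ i ∈ Finset.univ.filter (fun i => ¬ 0 < r i), (-r i)) := by ring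
  rw [h1, ← pow_mul, show k * 2 = 2 * k from mul_comm _ _, pow_mul, neg_one_sq, one_pow, one_mul]
  exact mul_pos hpos hneg'

/-- **The sign of Deligne's discriminant for `K = ℚ(√-d)`: `(-1)^k · q₀ > 0`.** Data: `IsWeilTypeCM A φ (S + d) 1 k`
(`d ≥ 1`), a rational class `h`, Rosati-compatible with `φ` and a real multiple of a Kähler class (this supplies the
Hodge–Riemann relation in degree one), and a discriminant witness `(x, ω, c, Φ)` with `t_K^{2k} det Φ = q₀ ∈ ℚ^×`.
Proof: Deligne (4.5) gives `ᵗḠ (t⁻¹Φᵀ) G = diag(dᵢ)` with `#{τ dᵢ > 0} = k` at `τ : t ↦ i√d`; the `dᵢ` are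
conjugation-fixed (the matrix `t⁻¹Φᵀ` is Hermitian by `cmConj_gram_eq_neg_swap`), hence real at `τ`, and non-zero;
determinants give `|τ det G|² · q₀ / d^{2k} = ∏ τ dᵢ`, whose sign is `(-1)^k` (`neg_one_pow_mul_prod_pos`). -/
theorem neg_one_pow_mul_ratDisc_pos [Fact (Irreducible (cmPolyQ (X + C (d : ℤ))))]
    [Fact (Irreducible (realPolyQ (X + C (d : ℤ))))] (hd : 0 < d) {k : ℕ}
    (hW : IsWeilTypeCM A φ (X + C (d : ℤ)) 1 k) {h : complexBetti A.X 2} (hQ : IsRationalClass h)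
    (hros : ∀ x y : complexBetti A.X 1,
      polarizationPairingOne A.X h (A.dim - 1) (pullbackOne A φ x) y =
        -polarizationPairingOne A.X h (A.dim - 1) x (pullbackOne A φ y))
    (hK : ∃ s : ℝ, s ≠ 0 ∧ IsKaehlerClass A.dim A.X ((s : ℂ) • h))
    {x : Fin (2 * k) → complexBetti A.X 1} {ω : complexBetti A.X (2 + 2 * (A.dim - 1))}
    {c : Fin (2 * k) → Fin (2 * k) → Fin (2 * 1) → ℚ}
    {Φ : Matrix (Fin (2 * k)) (Fin (2 * k)) (cmField (X + C (d : ℤ)))}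
    (hx : ∀ b, IsRationalClass (x b)) (hω : IsRationalClass ω) (hω0 : ω ≠ 0)
    (hQx : ∀ (a b : Fin (2 * k)) (j : Fin (2 * 1)),
      polarizationPairingOne A.X h (A.dim - 1) ((pullbackOne A φ ^ (j : ℕ)) (x a)) (x b) = ((c a b j : ℚ) : ℂ) • ω)
    (htr : ∀ (a b : Fin (2 * k)) (j : Fin (2 * 1)),
      Algebra.trace ℚ (cmField (X + C (d : ℤ))) (cmRoot (X + C (d : ℤ)) ^ (j : ℕ) * Φ a b) = c a b j)
    {q₀ : ℚ} (hq0 : q₀ ≠ 0)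
    (hq : AdjoinRoot.of (cmPolyQ (X + C (d : ℤ))) q₀ = cmRoot (X + C (d : ℤ)) ^ (2 * k) * Φ.det) :
    0 < (-1 : ℚ) ^ k * q₀ := by
  classical
  -- Hodge–Riemann in degree one from the Kähler multiple
  have h2 := hW.two_le_dim
  have hA : A.dim = A.dim - 1 + 1 := by omega
  have hK' : ∃ s : ℝ, s ≠ 0 ∧ IsKaehlerClass (A.dim - 1 + 1) A.X ((s : ℂ) • h) := by rw [← hA]; exact hK
  have hHR := hodgeRiemann_degreeOne_of_isKaehlerClass_smul (by omega) (Literature.AlgebraicGeometry.Motives.isSmoothProjective_of_dim_eq' hA) hQ hK'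
  have hΦ0 : Φ.det ≠ 0 := by
    intro h0
    rw [h0, mul_zero, map_eq_zero_iff _ (AdjoinRoot.of (cmPolyQ (X + C (d : ℤ)))).injective] at hq
    exact hq0 hq
  obtain ⟨G, dv, hG, hdiag, hcount⟩ := exists_orthogonalBasis_card_pos_eq hW hQ hros hHR hx hω hω0 hQx htr hΦ0
  have hR := hW.root_real_neg
  have hskew : ∀ a b, cmConj (X + C (d : ℤ)) (Φ a b) = -Φ b a := fun a b ↦ cmConj_gram_eq_neg_swap hW hros hω0 hQx htr a b
  have hσt : cmConj (X + C (d : ℤ)) (cmRoot (X + C (d : ℤ))) = -cmRoot (X + C (d : ℤ)) := cmConj_cmRoot _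
  have hdeg : (cmPolyQ (X + C (d : ℤ))).natDegree = 2 * 1 := hW.natDegree_cmPolyQ
  have ht0 : cmRoot (X + C (d : ℤ)) ≠ 0 := cmRoot_ne_zero (X + C (d : ℤ)) (by rw [hdeg])
  -- ### the `dᵢ` are conjugation-fixed (`t⁻¹Φᵀ` is Hermitian)
  have hH : ∀ a b, cmConj (X + C (d : ℤ)) (((cmRoot (X + C (d : ℤ)))⁻¹ • Φᵀ) a b) = ((cmRoot (X + C (d : ℤ)))⁻¹ • Φᵀ) b a := by
    intro a b
    simp only [Matrix.smul_apply, Matrix.transpose_apply, smul_eq_mul, map_mul, map_inv₀, hσt, hskew]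
    field_simp
  have hdfix : ∀ i, cmConj (X + C (d : ℤ)) (dv i) = dv i := by
    intro i
    have e := congrArg (fun M => M i i) hdiag
    simp only [Matrix.diagonal_apply_eq] at e
    rw [← e, Matrix.mul_apply]
    simp only [Matrix.mul_apply, Matrix.map_apply, Matrix.transpose_apply, map_sum, map_mul, cmConj_cmConj, hH,
      Finset.sum_mul]
    rw [Finset.sum_comm]
    refine Finset.sum_congr rfl fun a _ ↦ Finset.sum_congr rfl fun b _ ↦ ?_
    ring
  -- ### determinants: `σ(det G) · t^{-2k} det Φ · det G = ∏ dᵢ`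
  have hdet := congrArg Matrix.det hdiag
  rw [Matrix.det_mul, Matrix.det_mul, Matrix.det_diagonal, Matrix.det_smul, Matrix.det_transpose, Fintype.card_fin,
    ← AlgHom.mapMatrix_apply, ← AlgHom.map_det, Matrix.det_transpose] at hdet
  have hdv0 : ∀ i, dv i ≠ 0 := by
    have hprod : ∏ i, dv i ≠ 0 := by
      rw [← hdet]
      refine mul_ne_zero (mul_ne_zero ?_ (mul_ne_zero (pow_ne_zero _ (inv_ne_zero ht0)) hΦ0)) hG.ne_zero
      have hinjσ : Function.Injective (cmConj (X + C (d : ℤ))) := (cmConj (X + C (d : ℤ))).toRingHom.injective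
      rw [map_ne_zero_iff _ hinjσ]
      exact hG.ne_zero
    exact fun i ↦ (Finset.prod_ne_zero_iff.1 hprod) i (Finset.mem_univ i)
  -- ### at the embedding `τ : t ↦ i√d`
  let τ : cmField (X + C (d : ℤ)) →+* ℂ := AdjoinRoot.lift (algebraMap ℚ ℂ) (Complex.I * (Real.sqrt d : ℂ)) (by
    rw [cmPolyQ_quadratic, eval₂_add, eval₂_pow, eval₂_X, eval₂_C, map_natCast, I_mul_sqrt_sq, neg_add_cancel])
  have hτt : τ (cmRoot (X + C (d : ℤ))) = Complex.I * (Real.sqrt d : ℂ) := AdjoinRoot.lift_root _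
  have hτσ : ∀ e, τ (cmConj (X + C (d : ℤ)) e) = conj (τ e) := fun e ↦ ringHom_cmConj hR τ e
  have hτt2 : τ (cmRoot (X + C (d : ℤ))) ^ 2 = -(d : ℂ) := by rw [hτt, I_mul_sqrt_sq]
  have hτt0 : τ (cmRoot (X + C (d : ℤ))) ≠ 0 := fun h0 ↦ by
    rw [h0, zero_pow two_ne_zero, eq_comm, neg_eq_zero, Nat.cast_eq_zero] at hτt2
    exact hd.ne' hτt2
  have hreal : ∀ i, ((τ (dv i)).re : ℂ) = τ (dv i) := fun i ↦ by
    have h1 := hτσ (dv i)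
    rw [hdfix] at h1
    exact Complex.conj_eq_iff_re.1 h1.symm
  have hr0 : ∀ i, (τ (dv i)).re ≠ 0 := fun i h0 ↦ by
    have h1 := hreal i
    rw [h0, Complex.ofReal_zero] at h1
    exact hdv0 i ((map_eq_zero_iff τ τ.injective).1 h1.symm)
  have hsign := neg_one_pow_mul_prod_pos (fun i ↦ (τ (dv i)).re) hr0 (hcount τ)
  -- apply `τ` to the determinant identity
  have key := congrArg τ hdet
  rw [map_mul, map_mul, map_mul, map_prod, map_pow, map_inv₀, hτσ] at key
  have hτq : (q₀ : ℂ) = τ (cmRoot (X + C (d : ℤ))) ^ (2 * k) * τ Φ.det := by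
    have h1 := congrArg τ hq
    rwa [map_mul, map_pow, eq_ratCast, map_ratCast] at h1
  set g : ℂ := τ G.det with hg
  have hg0 : g ≠ 0 := (map_ne_zero_iff τ τ.injective).2 hG.ne_zero
  have hng : 0 < Complex.normSq g := Complex.normSq_pos.2 hg0
  -- `∏ τ dᵢ = |g|² q₀ / d^{2k}` (real numbers)
  have hprodC : (∏ i, τ (dv i)) = ((Complex.normSq g * (q₀ : ℝ) / (d : ℝ) ^ (2 * k) : ℝ) : ℂ) := by
    rw [← key]
    have hΦ : τ Φ.det = (q₀ : ℂ) / (τ (cmRoot (X + C (d : ℤ)))) ^ (2 * k) := by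
      rw [hτq, mul_div_cancel_left₀ _ (pow_ne_zero _ hτt0)]
    have hu2 : (τ (cmRoot (X + C (d : ℤ))) ^ (2 * k)) ^ 2 = (d : ℂ) ^ (2 * k) := by
      rw [← pow_mul, show 2 * k * 2 = 2 * (2 * k) by ring, pow_mul, hτt2, Even.neg_pow (even_two_mul k)]
    have hu0 : τ (cmRoot (X + C (d : ℤ))) ^ (2 * k) ≠ 0 := pow_ne_zero _ hτt0
    rw [hΦ, inv_pow]
    push_cast
    rw [Complex.normSq_eq_conj_mul_self, ← hu2]
    field_simp
  have hprodR : ∏ i, (τ (dv i)).re = Complex.normSq g * (q₀ : ℝ) / (d : ℝ) ^ (2 * k) := by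
    apply Complex.ofReal_injective
    rw [← hprodC, Complex.ofReal_prod]
    exact Finset.prod_congr rfl fun i _ ↦ hreal i
  rw [hprodR] at hsign
  have hdpos : 0 < (d : ℝ) ^ (2 * k) := pow_pos (Nat.cast_pos.2 hd) _
  have h3 : 0 < (-1 : ℝ) ^ k * (q₀ : ℝ) := by
    have h4 : (-1 : ℝ) ^ k * (Complex.normSq g * (q₀ : ℝ) / (d : ℝ) ^ (2 * k)) =
        ((-1 : ℝ) ^ k * (q₀ : ℝ)) * (Complex.normSq g / (d : ℝ) ^ (2 * k)) := by ring
    rw [h4] at hsign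
    exact (pos_iff_pos_of_mul_pos hsign).2 (div_pos hng hdpos)
  exact_mod_cast h3

end Summit.HodgeConjecture.HodgeConjecture.BiquadraticSecantLift
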